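import Mathlib
import Summits.Ventures.PercRepro2.SwOutCrossGenIterThm

/-!
# Iterating the extra vertex, IV: the inequality of the bit construction and any number of extra
dropped vertices (blind cell PercRepro2, night-4 g24, 2026-08-28; proofs/NIGHT4-G24.md §10)

The cube of `F.bit` is the extended cube of `F` (`LeakI_bit`, `ERI_bit`, `EBI_bit`, `QI_bit`), so
`ineq_bit_aux` gives **`ineq_bit`**: `Ineq F ι → Ineq F.bit ι`.  Iterating from a `FibreDataBit`
— the cross fibre with `thetaKE` — gives the abstract theorem of boundary (iv) for a connected
cross component with ANY NUMBER of extra single dropped vertices at the same junction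
(`ineq_bitN`, `card_le_crossKEEBitN`).
-/

namespace Summit.Ventures.PercRepro2

namespace CrossArm

section Transfer

variable {W A L : Type*} {ι : Type*} (F : FibreIter W A L)

/-- The leak of the bit construction is the extended leak. -/
lemma LeakI_bit (x : PtBG W ι) : LeakI F.bit x ↔ LeakBI F x := by
  obtain ⟨s, w, a, e⟩ := x
  simp only [LeakI, LeakBI, FibreIter.bit, Bool.or_eq_true, Bool.and_eq_true, Bool.not_eq_true',
    Bool.not_not]
  cases a <;> cases e <;> simp <;> tauto

/-- A lifted atom is in the lifted image iff the atom is in the set. -/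
lemma liftAtom_mem_image_iff (S : Set (AtomG A ι)) (b : AtomG A ι) :
    liftAtom b ∈ liftAtom '' S ↔ b ∈ S :=
  Function.Injective.mem_set_image liftAtom_injective

/-- The red atoms of the bit construction are the extended red atoms. -/
lemma ERI_bit (x : PtBG W ι) : ERI F.bit x = ERBI F x := by
  ext a
  rcases a with j | (u | (a | u))
  · show x.1 j = true ↔ _
    rw [ERBI, Set.mem_union]
    constructor
    · intro h
      exact Or.inl ((liftAtom_mem_image_iff _ (Sum.inl j)).2 h)
    · rintro (h | ⟨h, -⟩)
      · exact (liftAtom_mem_image_iff _ (Sum.inl j)).1 h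
      · exact absurd h (by simp [vAtom])
  · show redUG x.1 ↔ _
    rw [ERBI, Set.mem_union]
    constructor
    · intro h
      exact Or.inl ((liftAtom_mem_image_iff _ (Sum.inr (Sum.inl u))).2 h)
    · rintro (h | ⟨h, -⟩)
      · exact (liftAtom_mem_image_iff _ (Sum.inr (Sum.inl u))).1 h
      · exact absurd h (by simp [vAtom])
  · show redUG x.1 ∧ F.red x.2.1 a = true ↔ _
    rw [ERBI, Set.mem_union]
    constructor
    · intro h
      exact Or.inl ((liftAtom_mem_image_iff _ (Sum.inr (Sum.inr a))).2 h)
    · rintro (h | ⟨h, -⟩)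
      · exact (liftAtom_mem_image_iff _ (Sum.inr (Sum.inr a))).1 h
      · exact absurd h (by simp [vAtom])
  · show redUG x.1 ∧ x.2.2.1 = true ↔ _
    rw [ERBI, Set.mem_union]
    constructor
    · intro h
      exact Or.inr ⟨rfl, h.2, h.1⟩
    · rintro (h | ⟨-, h1, h2⟩)
      · exact absurd h (vAtom_notMem_lift _)
      · exact ⟨h2, h1⟩

/-- The blue atoms of the bit construction are the extended blue atoms. -/
lemma EBI_bit (x : PtBG W ι) : EBI F.bit x = EBBI F x := by
  show ERI F.bit (flipI F.bit x) = ERBI F (flipBI F x)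
  rw [ERI_bit]
  rfl

/-- The up-sets of types of the bit construction are the extended up-sets. -/
lemma isUpBI_of_isUpI {𝒯 : Set (TypBG L ι)} (h : IsUpI F.bit 𝒯) : IsUpBI F 𝒯 :=
  fun t ht t' hle => h t ht t' hle

variable [Fintype ι] [DecidableEq ι] [Fintype W] [DecidableEq W]

open scoped Classical

omit [DecidableEq W] in
/-- The non-leaking points of the bit construction are those of the extended cube. -/
lemma QI_bit (𝒯 : Set (TypBG L ι)) : QI F.bit 𝒯 = QBI F 𝒯 := by
  ext x
  rw [mem_QI, mem_QBI, LeakI_bit]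
  rfl

variable [Nonempty ι]

/-- **The inequality of the bit construction.** -/
theorem ineq_bit (hineq : Ineq F (ι := ι)) : Ineq F.bit (ι := ι) := by
  intro 𝒯 𝓔 h𝒯 h𝓔
  have e1 : ((QI F.bit 𝒯).filter fun q => ERI F.bit q ∈ 𝓔) =
      (QBI F 𝒯).filter fun x => ERBI F x ∈ 𝓔 := by
    rw [QI_bit]
    exact Finset.filter_congr fun x _ => by rw [ERI_bit]
  have e2 : ((QI F.bit 𝒯).filter fun q => EBI F.bit q ∈ 𝓔) =
      (QBI F 𝒯).filter fun x => EBBI F x ∈ 𝓔 := by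
    rw [QI_bit]
    exact Finset.filter_congr fun x _ => by rw [EBI_bit]
  rw [e1, e2]
  exact ineq_bit_aux F hineq (isUpBI_of_isUpI F h𝒯) h𝓔

end Transfer

section Iterate

/-- The fibre points with `n` extra vertices. -/
def bitsW (W : Type*) : ℕ → Type _
  | 0 => W
  | n + 1 => bitsW W n × (Bool × Bool)

/-- The atoms with `n` extra vertices. -/
def bitsA (A : Type*) : ℕ → Type _
  | 0 => A
  | n + 1 => bitsA A n ⊕ Unit

/-- The labels with `n` extra vertices. -/
def bitsL (L : Type*) : ℕ → Type _
  | 0 => L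
  | n + 1 => bitsL L n × Bool

/-- The fibre data with `n` extra vertices. -/
def FibreIter.bitN {W A L : Type*} (F : FibreIter W A L) : ∀ n, FibreIter (bitsW W n) (bitsA A n) (bitsL L n)
  | 0 => F
  | n + 1 => (F.bitN n).bit

/-- `bitsW W n` is finite with decidable equality when `W` is. -/
instance instFintypeBitsW (W : Type*) [Fintype W] : ∀ n, Fintype (bitsW W n)
  | 0 => inferInstanceAs (Fintype W)
  | n + 1 => @instFintypeProd _ _ (instFintypeBitsW W n) inferInstance

/-- `bitsW W n` has decidable equality when `W` has. -/
instance instDecidableEqBitsW (W : Type*) [DecidableEq W] : ∀ n, DecidableEq (bitsW W n)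
  | 0 => inferInstanceAs (DecidableEq W)
  | n + 1 => @instDecidableEqProd _ _ (instDecidableEqBitsW W n) inferInstance

variable {W A L : Type*} {ι : Type*} [Fintype ι] [DecidableEq ι] [Nonempty ι] [Fintype W] [DecidableEq W]

/-- **The inequality with `n` extra dropped vertices.** -/
theorem ineq_bitN (F : FibreIter W A L) (hineq : Ineq F (ι := ι)) :
    ∀ n, Ineq (F.bitN n) (ι := ι)
  | 0 => hineq
  | n + 1 => ineq_bit (F.bitN n) (ineq_bitN F hineq n)

end Iterate

section Cross

variable {V : Type*} (G : SimpleGraph V) [Fintype V] [DecidableEq V] [DecidableRel G.Adj]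
  [Nonempty V] (hG : G.Connected) {ι : Type*} [Fintype ι] [DecidableEq ι] [Nonempty ι]

/-- **THE ABSTRACT THEOREM OF BOUNDARY (iv) FOR A CONNECTED COMPONENT WITH ANY NUMBER OF EXTRA
DROPPED VERTICES** at the same junction. -/
theorem card_le_crossKEEBitN (n : ℕ) : Ineq ((FibreIter.ofBit (fibKEEBit G hG)).bitN n) (ι := ι) :=
  ineq_bitN _ (ineq_ofBit (fibKEEBit G hG)) n

end Cross

end CrossArm

end Summit.Ventures.PercRepro2
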